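import Summits.NavierStokesRegularity.NavierStokesRegularity.Theorems.RecurrentProfilesRecurrentLiouvilleFrNoInvariantClusterPoint
import Summits.NavierStokesRegularity.NavierStokesRegularity.Theorems.RecurrentProfilesRecurrentReductionOrbit
import Literature.Analysis.FluidPDE.ScalingUniformRecurrence
import HarnessLib

/-!
# Crux `RecurrentLiouville` (stmt-NavierStokesRegularity-1589), line `Sketch` (v8 "Lebesgue rungs") —
  stub S3: the subcritical backward `L^q` rung (`1 ≤ q < 3`, including finite energy `q = 2`)

`stub_lebSubcriticalBackward`: let `(u, p)` be a suitable weak solution of Navier–Stokes (`ν = 1`,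
`f = 0`) on the backward slab `ℝ³ × ℝ₋ = (-∞, 0) × ℝ³` with weak gradient `G`, Albritton–Barker
quantity `𝐈(ℝ³ × ℝ₋) < ∞` and the Type-I rate `‖u(t, x)‖ ≤ C/√(−t)`.  If for some `1 ≤ q < 3` the
slices `u(t)` are bounded in `L^q(ℝ³)`, `‖u(t)‖_{L^q} ≤ E < ∞`, for almost every time `t` of some
half-line `(−∞, T₀)` (for `q = 2`: finite energy in the far past), then the space–time origin is NOT
a backward singular point of `u`.

Proof (zoom-OUT along the scaling orbit + class compactness; bookkeeping over tree-proved facts).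
* Suppose the origin is singular.  By `exists_orbit_limit` (Albritton–Barker 2019, Lemma 2.2 +
  Prop. 2.3 on the orbit `u_c(t, x) = c u(c² t, c x)`, every point of which is singular) the orbit
  points `u_{c_j}`, `c_j = ψ j + 1 → ∞`, converge in every `L³(Q(0, R))` to a slab profile `u'` of
  the class with a backward-SINGULAR origin.
* Smallness (`lebSub_eLpNorm_nsRescale_box_le`): on a box `B = (−R², −δ) × B(0, R)`, `δ > 0`,
  the exact space–time scaling law of `L^q` norms (`eLpNorm_nsRescale_restrict_preimage`, Jacobian
  `c⁵`) and Tonelli in time (`lebSub_eLpNorm_prod_univ_le`) give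
  `‖u_c‖_{L^q(B)} ≤ c (c⁵)^{-1/q} ‖u‖_{L^q((−c²R², −c²δ) × ℝ³)} ≤ c^{1 − 3/q} (R² − δ)^{1/q} E → 0`
  as `c → ∞`, as soon as `−c² δ ≤ T₀` (`lebSub_tendsto_scalingFactor`: `1 − 3/q < 0`).
* Identification (`lebSub_eLpNorm_box_eq_zero`): `L³(Q(0,R)) → L^q(B)` on the finite-measure box
  (`q ≤ 3`), so `‖u'‖_{L^q(B)} ≤ ‖u_{c_j} − u'‖_{L^q(B)} + ‖u_{c_j}‖_{L^q(B)} → 0`; hence `u' = 0`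
  a.e. on every box, i.e. a.e. on the slab (the boxes `(−(n+1)², −1/(n+1)) × B(0, n+1)` exhaust it),
  and a field vanishing a.e. on the slab is not singular
  (`frNoInvariantClusterPoint_not_singular_of_ae_zero`) — contradiction.  This is the subcritical
  Lebesgue rung of D. Chae's exclusion scheme (Math. Ann. 338 (2007), Thm 1.5) in the decay-free
  suitable weak Type-I class.

## References

* D. Albritton, T. Barker, *On local Type I singularities of the Navier–Stokes equations and
  Liouville theorems*, J. Math. Fluid Mech. 21 (2019) no. 43 = arXiv:1811.00502, Lemma 2.2,
  Prop. 2.3, §3. [AlbrittonBarker2019]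
* D. Chae, *Nonexistence of asymptotically self-similar singularities in the Euler and the
  Navier–Stokes equations*, Math. Ann. 338 (2007) 435–449 = arXiv:math/0604234, Thm 1.5. [Chae2007]
-/

noncomputable section

-- the sub-problem namespace repeats the summit name (D-0017 layout `Summit.<S>.<P>.Theorems`)
set_option linter.dupNamespace false

namespace Summit.NavierStokesRegularity.NavierStokesRegularity.Theorems

open MeasureTheory Set Function Filter Topology TopologicalSpace Metric
open Literature.Analysis Literature.Analysis.FluidPDE
open scoped NNReal ENNReal

/-! ## Real-variable bookkeeping: the scaling factor `c^{1 - 3/q}` -/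

/-- The scaling identity `c · (c⁵)^{-1/q} · (c² K)^{1/q} = c^{1 − 3/q} K^{1/q}` (`c > 0`, `K ≥ 0`).
[folklore] -/
private theorem lebSub_scalingFactor_eq {c q K : ℝ} (hc : 0 < c) (hK : 0 ≤ K) :
    c * ((c ^ 2 * c ^ 3)⁻¹) ^ (1 / q) * (c ^ 2 * K) ^ (1 / q) =
      c ^ (1 - 3 / q) * K ^ (1 / q) := by
  have h5 : (c ^ 2 * c ^ 3) ^ (1 / q) = c ^ (5 / q) := by
    rw [← pow_add, ← Real.rpow_natCast, ← Real.rpow_mul hc.le]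
    congr 1
    push_cast
    ring
  have h2 : (c ^ 2) ^ (1 / q) = c ^ (2 / q) := by
    rw [← Real.rpow_natCast, ← Real.rpow_mul hc.le]
    congr 1
    push_cast
    ring
  rw [Real.mul_rpow (by positivity) hK, Real.inv_rpow (by positivity), h5, h2, ← Real.rpow_neg hc.le,
    show c ^ (1 - 3 / q) = c ^ ((1 : ℝ) + -(5 / q) + 2 / q) by congr 1; ring,
    Real.rpow_add hc, Real.rpow_add hc, Real.rpow_one]
  ring

/-- **The zoom-out factor tends to zero for subcritical exponents**: for `1 ≤ q < 3` and `δ ≤ R²`,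
`c · (c⁵)^{-1/q} · (c²R² − c²δ)^{1/q} = c^{1 − 3/q} (R² − δ)^{1/q} → 0` as `c → ∞`. [folklore] -/
theorem lebSub_tendsto_scalingFactor {q : ℝ} (hq1 : 1 ≤ q) (hq3 : q < 3) {R δ : ℝ} (hδR : δ ≤ R ^ 2) :
    Tendsto (fun c : ℝ => c * ((c ^ 2 * c ^ 3)⁻¹) ^ (1 / q) * (-(c ^ 2 * δ) - -(c ^ 2 * R ^ 2)) ^ (1 / q))
      atTop (𝓝 0) := by
  have hq0 : 0 < q := by linarith
  have hexp : 0 < 3 / q - 1 := by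
    rw [sub_pos, lt_div_iff₀ hq0]
    linarith
  have h := (tendsto_rpow_neg_atTop hexp).mul_const ((R ^ 2 - δ) ^ (1 / q))
  rw [zero_mul] at h
  refine h.congr' ?_
  filter_upwards [eventually_gt_atTop 0] with c hc
  rw [show -(c ^ 2 * δ) - -(c ^ 2 * R ^ 2) = c ^ 2 * (R ^ 2 - δ) by ring,
    lebSub_scalingFactor_eq hc (sub_nonneg.2 hδR)]
  congr 1
  ring

/-! ## `L^q` bookkeeping on product sets and boxes -/

/-- **Tonelli bound for `L^q` of a space–time field on `J × ℝ³` from slice bounds**: if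
`‖u(t)‖_{L^q(ℝ³)} ≤ E` for a.e. `t ∈ J`, then `‖u‖_{L^q(J × ℝ³)} ≤ E |J|^{1/q}` (`0 < q < ∞`; no
measurability needed, `lintegral_prod_le`). [folklore] -/
private theorem lebSub_eLpNorm_prod_univ_le
    (u : ℝ → EuclideanSpace ℝ (Fin 3) → EuclideanSpace ℝ (Fin 3)) {q : ℝ≥0∞} (hq0 : q ≠ 0)
    (hqt : q ≠ ⊤) {J : Set ℝ} {E : ℝ≥0∞}
    (hE : ∀ᵐ t ∂((volume : Measure ℝ).restrict J), eLpNorm (u t) q volume ≤ E) :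
    eLpNorm (uncurry u) q (volume.restrict (J ×ˢ (univ : Set (EuclideanSpace ℝ (Fin 3))))) ≤
      E * volume J ^ (1 / q.toReal) := by
  have hq : 0 < q.toReal := ENNReal.toReal_pos hq0 hqt
  rw [eLpNorm_eq_lintegral_rpow_enorm_toReal hq0 hqt]
  have h1 : ∫⁻ z, ‖uncurry u z‖ₑ ^ q.toReal
      ∂(volume.restrict (J ×ˢ (univ : Set (EuclideanSpace ℝ (Fin 3))))) ≤ E ^ q.toReal * volume J := by
    rw [Measure.volume_eq_prod, ← Measure.restrict_prod_eq_prod_univ]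
    calc ∫⁻ z, ‖uncurry u z‖ₑ ^ q.toReal ∂(((volume : Measure ℝ).restrict J).prod
          (volume : Measure (EuclideanSpace ℝ (Fin 3))))
        ≤ ∫⁻ t, ∫⁻ x, ‖u t x‖ₑ ^ q.toReal ∂volume ∂((volume : Measure ℝ).restrict J) :=
          lintegral_prod_le _
      _ = ∫⁻ t, eLpNorm (u t) q volume ^ q.toReal ∂((volume : Measure ℝ).restrict J) := by
          refine lintegral_congr fun t => ?_
          rw [eLpNorm_eq_lintegral_rpow_enorm_toReal hq0 hqt, ← ENNReal.rpow_mul, one_div,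
            inv_mul_cancel₀ hq.ne', ENNReal.rpow_one]
      _ ≤ ∫⁻ _t, E ^ q.toReal ∂((volume : Measure ℝ).restrict J) :=
          lintegral_mono_ae (hE.mono fun t ht => by gcongr)
      _ = E ^ q.toReal * volume J := by rw [lintegral_const, Measure.restrict_apply_univ]
  calc (∫⁻ z, ‖uncurry u z‖ₑ ^ q.toReal
        ∂(volume.restrict (J ×ˢ (univ : Set (EuclideanSpace ℝ (Fin 3)))))) ^ (1 / q.toReal)
      ≤ (E ^ q.toReal * volume J) ^ (1 / q.toReal) := by gcongr
    _ = E * volume J ^ (1 / q.toReal) := by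
        rw [ENNReal.mul_rpow_of_nonneg _ _ (by positivity), ← ENNReal.rpow_mul,
          mul_one_div_cancel hq.ne', ENNReal.rpow_one]

/-- **Smallness of zoomed-out fields on a box** (the subcritical scaling gain).  If
`‖u(t)‖_{L^q} ≤ E` for a.e. `t < T`, then for `c > 0` with `−c²δ ≤ T` and `δ ≤ R²`,
`‖u_c‖_{L^q((−R², −δ) × B(0,R))} ≤ c (c⁵)^{-1/q} (c²R² − c²δ)^{1/q} · E`: the box lies in
`Φ_c⁻¹((−c²R², −c²δ) × ℝ³)`, `Φ_c(s, y) = (c² s, c y)`, the exact scaling law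
`eLpNorm_nsRescale_restrict_preimage` (Jacobian `c^{2+3}`) and the Tonelli bound
`lebSub_eLpNorm_prod_univ_le` on the dilated time interval, of length `c²(R² − δ)`.
[cite: AlbrittonBarker2019, §3 (scaling of the class)] -/
theorem lebSub_eLpNorm_nsRescale_box_le
    {u : ℝ → EuclideanSpace ℝ (Fin 3) → EuclideanSpace ℝ (Fin 3)} {q : ℝ≥0∞} (hq0 : q ≠ 0)
    (hqt : q ≠ ⊤) {T : ℝ} {E : ℝ≥0∞}
    (hbd : ∀ᵐ t ∂(volume : Measure ℝ), t < T → eLpNorm (u t) q volume ≤ E)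
    {c R δ : ℝ} (hc : 0 < c) (hcT : -(c ^ 2 * δ) ≤ T) (hδR : δ ≤ R ^ 2) :
    eLpNorm (uncurry (nsRescale c u)) q
        (volume.restrict (Ioo (-R ^ 2) (-δ) ×ˢ ball (0 : EuclideanSpace ℝ (Fin 3)) R)) ≤
      ENNReal.ofReal (c * ((c ^ 2 * c ^ 3)⁻¹) ^ (1 / q.toReal) *
        (-(c ^ 2 * δ) - -(c ^ 2 * R ^ 2)) ^ (1 / q.toReal)) * E := by
  set J : Set ℝ := Ioo (-(c ^ 2 * R ^ 2)) (-(c ^ 2 * δ)) with hJ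
  have hc2 : 0 < c ^ 2 := by positivity
  -- the box lies in the preimage of the dilated slab piece `J × ℝ³`
  have hsub : (Ioo (-R ^ 2) (-δ) ×ˢ ball (0 : EuclideanSpace ℝ (Fin 3)) R) ⊆
      stAffine (c ^ 2) c 0 (0 : EuclideanSpace ℝ (Fin 3)) ⁻¹'
        (J ×ˢ (univ : Set (EuclideanSpace ℝ (Fin 3)))) := by
    rintro ⟨s, y⟩ ⟨⟨hs1, hs2⟩, -⟩
    simp only [hJ, mem_preimage, stAffine_apply, zero_add, mem_prod, mem_Ioo, mem_univ, and_true]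
    constructor <;> nlinarith
  -- slice bounds on the dilated time interval (it lies below `T`)
  have hJE : ∀ᵐ t ∂((volume : Measure ℝ).restrict J), eLpNorm (u t) q volume ≤ E := by
    filter_upwards [ae_restrict_mem measurableSet_Ioo, ae_restrict_of_ae (s := J) hbd] with t ht h
    exact h (ht.2.trans_le hcT)
  have hK : 0 ≤ -(c ^ 2 * δ) - -(c ^ 2 * R ^ 2) := by nlinarith
  calc eLpNorm (uncurry (nsRescale c u)) q
        (volume.restrict (Ioo (-R ^ 2) (-δ) ×ˢ ball (0 : EuclideanSpace ℝ (Fin 3)) R))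
      ≤ eLpNorm (fun z : ℝ × EuclideanSpace ℝ (Fin 3) => nsRescale c u z.1 z.2) q
          (volume.restrict (stAffine (c ^ 2) c 0 (0 : EuclideanSpace ℝ (Fin 3)) ⁻¹'
            (J ×ˢ (univ : Set (EuclideanSpace ℝ (Fin 3)))))) :=
        eLpNorm_mono_measure _ (Measure.restrict_mono hsub le_rfl)
    _ = ‖c‖ₑ * (ENNReal.ofReal (c ^ 2 * c ^ Module.finrank ℝ (EuclideanSpace ℝ (Fin 3)))⁻¹) ^
          (1 / q).toReal * eLpNorm (fun z : ℝ × EuclideanSpace ℝ (Fin 3) => u z.1 z.2) q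
            (volume.restrict (J ×ˢ (univ : Set (EuclideanSpace ℝ (Fin 3))))) :=
        eLpNorm_nsRescale_restrict_preimage hc u q _
    _ ≤ ‖c‖ₑ * (ENNReal.ofReal (c ^ 2 * c ^ Module.finrank ℝ (EuclideanSpace ℝ (Fin 3)))⁻¹) ^
          (1 / q).toReal * (E * volume J ^ (1 / q.toReal)) := by
        gcongr
        exact lebSub_eLpNorm_prod_univ_le u hq0 hqt hJE
    _ = ENNReal.ofReal (c * ((c ^ 2 * c ^ 3)⁻¹) ^ (1 / q.toReal) *
          (-(c ^ 2 * δ) - -(c ^ 2 * R ^ 2)) ^ (1 / q.toReal)) * E := by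
        rw [finrank_euclideanSpace_fin, hJ, Real.volume_Ioo, Real.enorm_eq_ofReal hc.le,
          ENNReal.toReal_div, ENNReal.toReal_one,
          ENNReal.ofReal_rpow_of_nonneg (by positivity) (by positivity),
          ENNReal.ofReal_rpow_of_nonneg hK (by positivity),
          ENNReal.ofReal_mul (by positivity), ENNReal.ofReal_mul hc.le]
        ring

/-- The box `(−R², −δ) × B(0, R)` (`0 ≤ δ`) lies in the parabolic ball `Q(0, R)`. [folklore] -/
private theorem lebSub_box_subset_parabolicCylinder {R δ : ℝ} (hδ : 0 ≤ δ) :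
    (Ioo (-R ^ 2) (-δ) ×ˢ ball (0 : EuclideanSpace ℝ (Fin 3)) R) ⊆
      parabolicCylinder R (0 : ℝ × EuclideanSpace ℝ (Fin 3)) := by
  rintro ⟨s, y⟩ ⟨⟨hs1, hs2⟩, hy⟩
  rw [SuitableCompactness.mem_parabolicCylinder_zero]
  exact ⟨⟨hs1, by linarith⟩, mem_ball_zero_iff.1 hy⟩

/-- The box `(−R², −δ) × B(0, R)` has finite volume. [folklore] -/
private theorem lebSub_volume_box_ne_top (R δ : ℝ) :
    volume (Ioo (-R ^ 2) (-δ) ×ˢ ball (0 : EuclideanSpace ℝ (Fin 3)) R) ≠ ⊤ := by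
  rw [Measure.volume_eq_prod, Measure.prod_prod, Real.volume_Ioo]
  exact ENNReal.mul_ne_top ENNReal.ofReal_ne_top measure_ball_lt_top.ne

/-- **Identification of the zoom-out limit as zero on a box.**  Let `1 ≤ q < 3`, let the slices of
`u` obey `‖u(t)‖_{L^q} ≤ E < ∞` for a.e. `t < T`, let `c_j > 0`, `c_j → ∞`, and let the zoomed-out
fields `u_{c_j}` converge in `L³(Q(0, R))` to a field `u'`.  Then `u'` vanishes in
`L^q((−R², −δ) × B(0, R))` for `0 < δ ≤ R²`: `L³ → L^q` on the finite-measure box, and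
`‖u'‖_{L^q(B)} ≤ ‖u_{c_j} − u'‖_{L^q(B)} + ‖u_{c_j}‖_{L^q(B)} → 0` by
`lebSub_eLpNorm_nsRescale_box_le` / `lebSub_tendsto_scalingFactor`.
[cite: Chae2007, Thm 1.5 (subcritical scaling gain)] -/
theorem lebSub_eLpNorm_box_eq_zero {q : ℝ≥0∞} (hq1 : 1 ≤ q) (hq3 : q < 3)
    {u u' : ℝ → EuclideanSpace ℝ (Fin 3) → EuclideanSpace ℝ (Fin 3)} {T : ℝ} {E : ℝ≥0∞}
    (hE : E < ⊤) (hbd : ∀ᵐ t ∂(volume : Measure ℝ), t < T → eLpNorm (u t) q volume ≤ E)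
    {c : ℕ → ℝ} (hc : ∀ j, 0 < c j) (hct : Tendsto c atTop atTop)
    {R δ : ℝ} (hδ : 0 < δ) (hδR : δ ≤ R ^ 2)
    (hvm : ∀ j, AEStronglyMeasurable (uncurry (nsRescale (c j) u))
      (volume.restrict (parabolicCylinder R (0 : ℝ × EuclideanSpace ℝ (Fin 3)))))
    (hwm : AEStronglyMeasurable (uncurry u')
      (volume.restrict (parabolicCylinder R (0 : ℝ × EuclideanSpace ℝ (Fin 3)))))
    (hconv : Tendsto (fun j => eLpNorm (uncurry (nsRescale (c j) u) - uncurry u') 3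
      (volume.restrict (parabolicCylinder R (0 : ℝ × EuclideanSpace ℝ (Fin 3))))) atTop (𝓝 0)) :
    eLpNorm (uncurry u') q
      (volume.restrict (Ioo (-R ^ 2) (-δ) ×ˢ ball (0 : EuclideanSpace ℝ (Fin 3)) R)) = 0 := by
  set B : Set (ℝ × EuclideanSpace ℝ (Fin 3)) :=
    Ioo (-R ^ 2) (-δ) ×ˢ ball (0 : EuclideanSpace ℝ (Fin 3)) R with hB
  set Q : Set (ℝ × EuclideanSpace ℝ (Fin 3)) :=
    parabolicCylinder R (0 : ℝ × EuclideanSpace ℝ (Fin 3)) with hQ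
  -- exponent bookkeeping
  have hq0 : q ≠ 0 := (zero_lt_one.trans_le hq1).ne'
  have hqt : q ≠ ⊤ := ne_top_of_lt hq3
  have hq3' : q.toReal < 3 := by
    have h := (ENNReal.toReal_lt_toReal hqt (by norm_num : (3 : ℝ≥0∞) ≠ ⊤)).2 hq3
    simpa using h
  have hq1' : 1 ≤ q.toReal := by
    have h := (ENNReal.toReal_le_toReal (by norm_num : (1 : ℝ≥0∞) ≠ ⊤) hqt).2 hq1
    simpa using h
  have hqpos : 0 < q.toReal := by linarith
  -- the box: in `Q(0, R)`, of finite measure; the Hölder factor `|B|^{1/q - 1/3}` is finite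
  have hBQ : B ⊆ Q := lebSub_box_subset_parabolicCylinder hδ.le
  set M : ℝ≥0∞ := volume B ^ (1 / q.toReal - 1 / (3 : ℝ≥0∞).toReal) with hM
  have hMt : M ≠ ⊤ := by
    refine ENNReal.rpow_ne_top_of_nonneg ?_ (lebSub_volume_box_ne_top R δ)
    rw [sub_nonneg, ENNReal.toReal_ofNat]
    exact one_div_le_one_div_of_le hqpos hq3'.le
  have hvmB : ∀ j, AEStronglyMeasurable (uncurry (nsRescale (c j) u)) (volume.restrict B) :=
    fun j => (hvm j).mono_measure (Measure.restrict_mono hBQ le_rfl)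
  have hwmB : AEStronglyMeasurable (uncurry u') (volume.restrict B) :=
    hwm.mono_measure (Measure.restrict_mono hBQ le_rfl)
  -- Step 1: Minkowski and `L³(Q) → L^q(B)`, for every `j`
  have hstep : ∀ j, eLpNorm (uncurry u') q (volume.restrict B) ≤
      eLpNorm (uncurry (nsRescale (c j) u) - uncurry u') 3 (volume.restrict Q) * M +
        eLpNorm (uncurry (nsRescale (c j) u)) q (volume.restrict B) := by
    intro j
    calc eLpNorm (uncurry u') q (volume.restrict B)
        = eLpNorm (uncurry (nsRescale (c j) u) - (uncurry (nsRescale (c j) u) - uncurry u')) q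
            (volume.restrict B) := by rw [sub_sub_cancel]
      _ ≤ eLpNorm (uncurry (nsRescale (c j) u)) q (volume.restrict B) +
            eLpNorm (uncurry (nsRescale (c j) u) - uncurry u') q (volume.restrict B) :=
          eLpNorm_sub_le (hvmB j) ((hvmB j).sub hwmB) hq1
      _ ≤ eLpNorm (uncurry (nsRescale (c j) u)) q (volume.restrict B) +
            eLpNorm (uncurry (nsRescale (c j) u) - uncurry u') 3 (volume.restrict B) *
              (volume.restrict B) univ ^ (1 / q.toReal - 1 / (3 : ℝ≥0∞).toReal) := by
          gcongr
          exact eLpNorm_le_eLpNorm_mul_rpow_measure_univ hq3.le ((hvmB j).sub hwmB)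
      _ ≤ eLpNorm (uncurry (nsRescale (c j) u)) q (volume.restrict B) +
            eLpNorm (uncurry (nsRescale (c j) u) - uncurry u') 3 (volume.restrict Q) * M := by
          rw [Measure.restrict_apply_univ]
          -- `‖·‖_{L³(B)} ≤ ‖·‖_{L³(Q)}` from `B ⊆ Q`
          gcongr
      _ = _ := add_comm _ _
  -- Step 2: eventually `-c_j² δ ≤ T`, so the smallness bound applies
  have hev : ∀ᶠ j in atTop, eLpNorm (uncurry (nsRescale (c j) u)) q (volume.restrict B) ≤
      ENNReal.ofReal (c j * ((c j ^ 2 * c j ^ 3)⁻¹) ^ (1 / q.toReal) *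
        (-(c j ^ 2 * δ) - -(c j ^ 2 * R ^ 2)) ^ (1 / q.toReal)) * E := by
    have h2 : Tendsto (fun j => c j ^ 2 * δ) atTop atTop :=
      ((tendsto_pow_atTop two_ne_zero).comp hct).atTop_mul_const hδ
    filter_upwards [h2.eventually_ge_atTop (-T)] with j hj
    exact lebSub_eLpNorm_nsRescale_box_le hq0 hqt hbd (hc j) (by linarith) hδR
  -- Step 3: the majorant tends to zero
  have hlim : Tendsto (fun j => eLpNorm (uncurry (nsRescale (c j) u) - uncurry u') 3
      (volume.restrict Q) * M + ENNReal.ofReal (c j * ((c j ^ 2 * c j ^ 3)⁻¹) ^ (1 / q.toReal) *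
        (-(c j ^ 2 * δ) - -(c j ^ 2 * R ^ 2)) ^ (1 / q.toReal)) * E) atTop (𝓝 0) := by
    have h1 : Tendsto (fun j => eLpNorm (uncurry (nsRescale (c j) u) - uncurry u') 3
        (volume.restrict Q) * M) atTop (𝓝 0) := by
      have h := ENNReal.Tendsto.mul_const hconv (Or.inr hMt)
      rwa [zero_mul] at h
    have h2 : Tendsto (fun j => ENNReal.ofReal (c j * ((c j ^ 2 * c j ^ 3)⁻¹) ^ (1 / q.toReal) *
        (-(c j ^ 2 * δ) - -(c j ^ 2 * R ^ 2)) ^ (1 / q.toReal)) * E) atTop (𝓝 0) := by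
      have hg := (lebSub_tendsto_scalingFactor hq1' hq3' hδR).comp hct
      have h := ENNReal.Tendsto.mul_const (ENNReal.tendsto_ofReal hg) (Or.inr hE.ne)
      rwa [ENNReal.ofReal_zero, zero_mul] at h
    simpa using h1.add h2
  -- Step 4: conclusion
  refine le_antisymm ?_ bot_le
  refine le_of_tendsto_of_tendsto tendsto_const_nhds hlim ?_
  filter_upwards [hev] with j hj
  exact (hstep j).trans (by gcongr)

/-- **The open backward slab is exhausted by the boxes** `(−(n+1)², −1/(n+1)) × B(0, n+1)`.
[folklore] -/
theorem lebSub_lowerHalf_subset_iUnion_box :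
    (Iio (0 : ℝ) ×ˢ (univ : Set (EuclideanSpace ℝ (Fin 3))) : Set (ℝ × EuclideanSpace ℝ (Fin 3))) ⊆
      ⋃ n : ℕ, Ioo (-((n : ℝ) + 1) ^ 2) (-((n : ℝ) + 1)⁻¹) ×ˢ
        ball (0 : EuclideanSpace ℝ (Fin 3)) ((n : ℝ) + 1) := by
  rintro ⟨s, y⟩ ⟨hs, -⟩
  have hs' : s < 0 := hs
  have hs0 : 0 < -s := by linarith
  obtain ⟨n, hn⟩ := exists_nat_ge (max (max (-s) (-s)⁻¹) ‖y‖)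
  have h1 : -s < (n : ℝ) + 1 := by
    have := (le_max_left _ _).trans ((le_max_left _ _).trans hn)
    linarith
  have h2 : (-s)⁻¹ < (n : ℝ) + 1 := by
    have := (le_max_right _ _).trans ((le_max_left _ _).trans hn)
    linarith
  have h3 : ‖y‖ < (n : ℝ) + 1 := by
    have := (le_max_right _ _).trans hn
    linarith
  refine mem_iUnion.2 ⟨n, ⟨?_, ?_⟩, mem_ball_zero_iff.2 h3⟩
  · show -((n : ℝ) + 1) ^ 2 < s
    nlinarith [n.cast_nonneg (α := ℝ)]
  · show s < -((n : ℝ) + 1)⁻¹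
    have := inv_lt_of_inv_lt₀ hs0 h2
    linarith

/-! ## Stub S3 — the subcritical backward `L^q` rung -/

/-- **S3 — subcritical backward integrability rung** (`1 ≤ q < 3`; `q = 2`: finite energy in the
far past).  A suitable weak solution `(u,p)` on `ℝ³ × ℝ₋` with weak gradient `G`, `𝐈 < ⊤` and the
rate `C`, whose slices are bounded in `L^q(ℝ³)` for almost every time of some half-line `(−∞, T₀)`,
is regular at the origin: otherwise a subsequence of the zoomed-out orbit `u_c`, `c = n + 1 → ∞`,
converges in `L³_loc` to a SINGULAR class profile `u'` (`exists_orbit_limit`, Albritton–Barker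
2019 Lemma 2.2 + Prop. 2.3), while `‖u_c‖_{L^q(B)} ≲ c^{1−3/q} → 0` on every box
`B = (−R², −δ) × B(0,R)` (`lebSub_eLpNorm_nsRescale_box_le`), so `u' = 0` a.e. on the slab
(`lebSub_eLpNorm_box_eq_zero`) — not singular (`frNoInvariantClusterPoint_not_singular_of_ae_zero`).
The subcritical Lebesgue rung of Chae's exclusion scheme in the decay-free suitable weak Type-I
class. [cite: Chae2007, Thm 1.5; AlbrittonBarker2019, Lemma 2.2 and Prop. 2.3] -/
theorem stub_lebSubcriticalBackward :
    ∀ (q : ℝ≥0∞), 1 ≤ q → q < 3 →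
    ∀ (C : ℝ) (u : ℝ → EuclideanSpace ℝ (Fin 3) → EuclideanSpace ℝ (Fin 3))
      (p : ℝ → EuclideanSpace ℝ (Fin 3) → ℝ)
      (G : ℝ → EuclideanSpace ℝ (Fin 3) → EuclideanSpace ℝ (Fin 3) →L[ℝ] EuclideanSpace ℝ (Fin 3)),
      IsSuitableWeakSolutionOn (slab (EuclideanSpace ℝ (Fin 3)) (Iio 0) isOpen_Iio) 1 0 u p →
      HasWeakSpatialGradientOn (slab (EuclideanSpace ℝ (Fin 3)) (Iio 0) isOpen_Iio) u G →
      typeIBound (Iio (0 : ℝ) ×ˢ univ) u p G < ⊤ →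
      HasTypeITimeDecay C u →
      (∃ (E : ℝ≥0∞) (T₀ : ℝ), E < ⊤ ∧
        ∀ᵐ t ∂(volume : Measure ℝ), t < T₀ → eLpNorm (u t) q volume ≤ E) →
      ¬ IsBackwardSingularPoint u 0 := by
  intro q hq1 hq3 C u p G hsw hwg hI hdec hLq hsing
  obtain ⟨E, T₀, hE, hbd⟩ := hLq
  have hq0 : q ≠ 0 := (zero_lt_one.trans_le hq1).ne'
  -- Step 1: the zoomed-out orbit `u_c`, `c = n + 1 → ∞`, subconverges to a singular class profile
  set c : ℕ → ℝ := fun n => (n : ℝ) + 1 with hc_def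
  have hc : ∀ n, 0 < c n := fun n => by positivity
  obtain ⟨u', p', H', ψ, hψ, -, hwg', -, hsing', -, hconv'⟩ :=
    exists_orbit_limit hsw hwg hI hsing hdec c hc
  have hct : Tendsto (fun j => c (ψ j)) atTop atTop :=
    tendsto_atTop_add_const_right _ 1 (tendsto_natCast_atTop_atTop.comp hψ.tendsto_atTop)
  -- measurability on the balls `Q(0, R)`
  have hvm : ∀ (R : ℝ) (j : ℕ), AEStronglyMeasurable (uncurry (nsRescale (c (ψ j)) u))
      (volume.restrict (parabolicCylinder R (0 : ℝ × EuclideanSpace ℝ (Fin 3)))) := by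
    intro R j
    rw [nsRescale_eq_zoom]
    exact (zoom_slabProfile hsw hwg (hc _)).2.1.locallyIntegrableOn.aestronglyMeasurable.mono_measure
      (Measure.restrict_mono (parabolicCylinder_origin_subset_slab _) le_rfl)
  have hwm : ∀ R : ℝ, AEStronglyMeasurable (uncurry u')
      (volume.restrict (parabolicCylinder R (0 : ℝ × EuclideanSpace ℝ (Fin 3)))) := fun R =>
    hwg'.locallyIntegrableOn.aestronglyMeasurable.mono_measure
      (Measure.restrict_mono (parabolicCylinder_origin_subset_slab _) le_rfl)
  -- Step 2: `u' = 0` a.e. on every box, hence a.e. on the slab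
  have hbox : ∀ n : ℕ, ∀ᵐ z ∂(volume.restrict (Ioo (-((n : ℝ) + 1) ^ 2) (-((n : ℝ) + 1)⁻¹) ×ˢ
      ball (0 : EuclideanSpace ℝ (Fin 3)) ((n : ℝ) + 1))),
      uncurry u' z = (0 : ℝ × EuclideanSpace ℝ (Fin 3) → EuclideanSpace ℝ (Fin 3)) z := by
    intro n
    have hR : (0 : ℝ) < (n : ℝ) + 1 := by positivity
    have hδ : (0 : ℝ) < ((n : ℝ) + 1)⁻¹ := by positivity
    have hδR : ((n : ℝ) + 1)⁻¹ ≤ ((n : ℝ) + 1) ^ 2 :=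
      (inv_le_one_of_one_le₀ (by linarith [n.cast_nonneg (α := ℝ)])).trans
        (one_le_pow₀ (by linarith [n.cast_nonneg (α := ℝ)]))
    have h0 := lebSub_eLpNorm_box_eq_zero hq1 hq3 hE hbd (c := fun j => c (ψ j))
      (fun j => hc _) hct hδ hδR (hvm _) (hwm _) (hconv' _ hR)
    exact (eLpNorm_eq_zero_iff ((hwm _).mono_measure
      (Measure.restrict_mono (lebSub_box_subset_parabolicCylinder hδ.le) le_rfl)) hq0).1 h0
  have hw0 : ∀ᵐ z ∂(volume.restrict (Iio (0 : ℝ) ×ˢ (univ : Set (EuclideanSpace ℝ (Fin 3))))),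
      uncurry u' z = (0 : ℝ × EuclideanSpace ℝ (Fin 3) → EuclideanSpace ℝ (Fin 3)) z := by
    refine ae_restrict_of_ae_restrict_of_subset lebSub_lowerHalf_subset_iUnion_box ?_
    rw [ae_restrict_iUnion_iff]
    exact hbox
  -- Step 3: a field vanishing a.e. on the slab is not singular — contradiction
  exact frNoInvariantClusterPoint_not_singular_of_ae_zero hw0 hsing'

end Summit.NavierStokesRegularity.NavierStokesRegularity.Theorems

end
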